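import Mathlib
import HarnessLib
import Literature.NumberTheory.Automorphic.StrongArtinGL2
import Literature.NumberTheory.Automorphic.TunnellOctahedralGlobal
import Literature.NumberTheory.Automorphic.TunnellOctahedralLocal
import Literature.NumberTheory.Automorphic.LanglandsTetrahedral
import Literature.NumberTheory.Automorphic.ChebotarevArtinRepHolds
import Literature.NumberTheory.Automorphic.BaseChangeCyclicCuspidal
import Literature.NumberTheory.GaloisRepresentations.GaloisRep
import Literature.NumberTheory.GaloisRepresentations.ArtinRestriction
import Literature.NumberTheory.Automorphic.BookerStrongArtinCuspidality
import Summits.Langlands.Langlands.Theorems.ParityBlindBianchiArtinWeightRealisationLevelStubExistsTraceNeZero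

/-!
# Stub `stub_inertNonTwistWitness` of line Sketch (crux stmt-Langlands-15111
`ParityBlindBianchi.ArtinWeightRealisationLevel`) — a non-twist witness at an inert place

Helper file (`--supports stmt-Langlands-15111`) of the ODD BASE-CHANGE SECTOR theorem of the
crux R′ (continuation lead c14).  To base-change the cuspidal `π = π(ρ)` of `GL₂(𝔸_ℚ)` attached to
an odd Artin representation `ρ : Γ_ℚ → GL₂(ℂ)` to a quadratic field `K` with a CUSPIDAL lift
(Arthur–Clozel 1989, Ch. 3, Thm. 4.2 (a), the tree's named fact `baseChange_cyclic_cuspidal`), one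
needs the printed hypothesis "`π ≇ π ⊗ η_{K/ℚ}`", rendered in the tree by a non-twist witness: a
place `v` of `ℚ` inert in `K` at which `π` has a Satake parameter `α` with `-α ≠ α`, i.e.
`tr t_{π,v} ≠ 0`.  This file produces it from the irreducibility of `ρ|_{Γ_K}`:

* `stub_inertNonTwistWitness` — the registered stub: Burnside (the landed
  `stub_existsTraceNeZero`: some `g₀ ∉ Γ_K` has `tr ρ(g₀) ≠ 0`), then Chebotarev for `ρ ⊕ χ_K`
  (`infinite_setOf_frob_eq_and_quadraticSign_eq_neg_one`, `chebotarev_artinRep_holds` — proved in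
  the tree) gives infinitely many places `v`, inert in `K` and unramified for `ρ`, whose Frobenius
  has `ρ(Frob_v) = ρ(g₀)`; at the cofinitely many of them where `π_v = π(ρ_v)`
  (`IsPiOfArtinRep`) the Satake parameter `α = {a, b}` has `a + b = tr ρ(g₀) ≠ 0`, so `-α ≠ α`
  (`map_neg_ne_of_sum_ne_zero`), and an inert `v` carries a place `w` of residue degree `2`.

No definitions, no named facts.
-/

noncomputable section

open scoped BigOperators Topology Classical Matrix NumberField MatrixGroups Polynomial
open Literature.NumberTheory.Automorphic Literature.NumberTheory.GaloisRepresentations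
  IsDedekindDomain NumberField Filter Polynomial

-- `Summit.Langlands.Langlands.…`: summit = sub-problem name (D-0017 nested layout), not a typo.
set_option linter.dupNamespace false

namespace Summit.Langlands.Langlands.Theorems.ArtinWeightRealisationLevel

/-! ### The stub -/

/-- **Stub `stub_inertNonTwistWitness` (a non-twist witness at an inert place).**  Let `K` be a
quadratic field, `ρ : Γ_ℚ → GL₂(ℂ)` an Artin representation whose restriction `ρ|_{Γ_K}` is
irreducible, and `π` a cuspidal automorphic representation of `GL₂(𝔸_ℚ)` with `π = π(ρ)` in
Tunnell's a.e. sense (`IsPiOfArtinRep`).  Then there are a place `v` of `ℚ`, a place `w ∣ v` of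
`K` of residue degree `2 = [K:ℚ]` (so `v` is inert) and a Satake parameter `α` of `π` at `v` with
`ζ • α ≠ α` for every primitive square root of unity `ζ` — the non-twist hypothesis of
Arthur–Clozel's Thm. 4.2 (a) as rendered by `baseChange_cyclic_cuspidal`.  Proof:
`stub_existsTraceNeZero` gives `g₀ ∈ Γ_ℚ ∖ Γ_K` with `tr ρ(g₀) ≠ 0` (Burnside,
`Γ_K` of index `2`); Chebotarev for `ρ ⊕ χ_K` (`infinite_setOf_frob_eq_and_quadraticSign_eq_neg_one`
with the PROVED `chebotarev_artinRep_holds`) gives infinitely many `v`, inert in `K` and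
unramified for `ρ`, with `ρ(Frob_v) = ρ(g₀)`; discarding the finitely many where `π_v ≠ π(ρ_v)`,
the Satake parameter `α = {a, b}` at such a `v` has `a + b = tr ρ(g₀) ≠ 0`
(`trace_eq_add_of_charpoly_eq`, Booker file), hence `-α ≠ α` (`map_neg_ne_of_sum_ne_zero`). [folklore] -/
theorem stub_inertNonTwistWitness : ∀ (K : Type) [Field K] [NumberField K], Module.finrank ℚ K = 2 → ∀ (ρ : Literature.NumberTheory.GaloisRepresentations.FramedArtinRep ℚ 2), (ρ.restrictField K).toGaloisRep.IsIrreducible → ∀ {hQ : Literature.NumberTheory.Automorphic.isCompact_glFiniteIntegralLevel 2 ℚ} (π : Literature.NumberTheory.Automorphic.CuspidalAutomorphicRepData 2 ℚ hQ), Literature.NumberTheory.Automorphic.IsPiOfArtinRep ρ π.1 → ∃ (v : IsDedekindDomain.HeightOneSpectrum (NumberField.RingOfIntegers ℚ)) (w : IsDedekindDomain.HeightOneSpectrum (NumberField.RingOfIntegers K)) (α : Multiset ℂ), w.asIdeal.under (NumberField.RingOfIntegers ℚ) = v.asIdeal ∧ w.asIdeal.inertiaDeg (NumberField.RingOfIntegers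 ℚ) = Module.finrank ℚ K ∧ π.1.HasSatakeParamAt v α ∧ ∀ ζ : ℂ, IsPrimitiveRoot ζ (Module.finrank ℚ K) → α.map (ζ * ·) ≠ α := by
  intro K _ _ hK ρ hirrK hQ π hπ
  -- (1) `Γ_K ≤ Γ_ℚ` is a proper subgroup (index `2`)
  haveI : FiniteDimensional ℚ K := Module.finite_of_finrank_eq_succ hK
  obtain ⟨-, hindex⟩ := isOpen_range_absGaloisRestrict_and_index ℚ K
  rw [hK] at hindex
  have hne : (absGaloisRestrict ℚ K).toMonoidHom.range ≠ ⊤ := by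
    intro htop
    have h1 : ((absGaloisRestrict ℚ K).range : Subgroup (Field.absoluteGaloisGroup ℚ)).index = 1 := by
      rw [Subgroup.index_eq_one]
      exact htop
    omega
  -- (2) Burnside: some `g₀ ∉ Γ_K` with `tr ρ(g₀) ≠ 0`
  have hirr' : Representation.IsIrreducible
      ((glStdRepresentation (Fin 2) ℂ).comp (ρ.toMonoidHom.comp (absGaloisRestrict ℚ K).toMonoidHom)) :=
    hirrK
  obtain ⟨g₀, hg₀, htr⟩ := stub_existsTraceNeZero ρ.toMonoidHom _ hne hirr'
  -- (3) Chebotarev for `ρ ⊕ χ_K`: infinitely many inert `v` with `ρ(Frob_v) = ρ(g₀)`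
  have hinf := infinite_setOf_frob_eq_and_quadraticSign_eq_neg_one (F := ℚ) (K := K)
    chebotarev_artinRep_holds ρ hK (g₀ := g₀) hg₀
  -- (4) discard the finitely many places where `π_v ≠ π(ρ_v)`
  have hfin : {v : HeightOneSpectrum (𝓞 ℚ) | ¬ FrobSatakeCompatibleAt ρ π.1 v}.Finite :=
    Filter.eventually_cofinite.mp hπ
  obtain ⟨v, ⟨hunr, hε, 𝔓, h𝔓, φ, hφ, hval⟩, hv⟩ := (hinf.sdiff hfin).nonempty
  have hcompat : FrobSatakeCompatibleAt ρ π.1 v := by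
    by_contra h; exact hv h
  obtain ⟨α, hsat, -, hchar⟩ := hcompat
  -- (5) the Satake parameter at `v`: `α = {a, b}` with `a + b = tr ρ(g₀) ≠ 0`
  obtain ⟨a, b, rfl⟩ := Multiset.card_eq_two.mp hsat.card_eq
  have hch : FramedRep.charpoly ρ φ = (X - C a) * (X - C b) := by
    rw [← satakePolynomial_pair]; exact hchar 𝔓 h𝔓 φ hφ
  have htrφ : ((ρ φ : GL (Fin 2) ℂ) : Matrix (Fin 2) (Fin 2) ℂ).trace = a + b :=
    trace_eq_add_of_charpoly_eq hch
  have hsum : ({a, b} : Multiset ℂ).sum ≠ 0 := by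
    rw [Multiset.sum_pair, ← htrφ]
    change ((ρ.toMonoidHom φ : GL (Fin 2) ℂ) : Matrix (Fin 2) (Fin 2) ℂ).trace ≠ 0
    have : ρ.toMonoidHom φ = ρ.toMonoidHom g₀ := hval
    rw [this]
    exact htr
  -- (6) a place `w ∣ v` of residue degree `2` (v is inert: `ε_K(v) = -1`)
  obtain ⟨w, hw⟩ := exists_above (E := K) v
  have hf : w.asIdeal.inertiaDeg (𝓞 ℚ) = 2 := by
    rcases inertiaDeg_eq_one_or_two_of_finrank_eq_two hK v w hw with h1 | h2
    · exfalso
      unfold quadraticSign at hε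
      rw [if_pos ⟨w, hw, h1⟩] at hε
      norm_num at hε
    · exact h2
  refine ⟨v, w, {a, b}, hw, by rw [hf, hK], hsat, fun ζ hζ => ?_⟩
  rw [hK] at hζ
  exact map_neg_ne_of_sum_ne_zero hsum hζ

end Summit.Langlands.Langlands.Theorems.ArtinWeightRealisationLevel

end
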